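import Summits.Ventures.Crystal3D.Theorems.StickyWulffConstantCoaxialWallLawOneFccUnimodalSums
import HarnessLib

/-!
# The TWO-FAMILY LEDGER of the OneFcc F_layer as a real inequality (file (f): the bookkeeping, abstracted from the cell)

HONEST FRAMING. Venture `Summits/Ventures/Crystal3D` (cell `crystal3d-full`); helper `--supports` the crux `CoaxialWallLaw`
(stmt-Ventures-19481, REGISTERED line `WallLedgerF`) in its role as owner of lane T's debt T-F2 / F_layer, OneFcc half (cf-p1 (civ)/(cxx));
memo HOME/wall-19481-p1/g16/TWO-FAMILY-LEDGER-g16.md §Ledger.  Pure real analysis, standard axioms; nothing about the crux is claimed; F-C1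
not moved.

THE LEDGER.  Plane `k` of the faulted plate has signed trace position `x_k = x₀ + k d` at the charge height; `G(x) = √((R²S² − x²)₊)`
(half-chord × `S`, `M = R S` its maximum); `ch i ∈ [0,1]` marks the charged bilayers, and the two source weights satisfy
`wA k + wN k = ch (k−1) + ch k` (A-admissible planes + B-non-exit planes = number of charged bilayers adjacent to plane `k`).  Inputs, all
at the per-plane line density `Φ ≥ 4/S`:
(I1) `srcA ≥ Σ_k wA k (Φ G(x_k + ψ) − 3)`; (I2) `srcB ≥ Σ_k (Φ G(x_k + ψ') − 3)` with `|ψ' − ψ| ≤ d` (the fcc plate's planes, re-indexed);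
(I3) `exitB ≤ Σ_k (1 − wN k)(Φ G(x_k + ψ) + 3) + Eex`; (I4) `2Q ≤ (2d/S) Σ_i ch i · G(p_i) + EQ`, `p_i` the point of the cell
`[x_i − 1, x_{i+1} + 1]` nearest `0`; (I5) the row: `srcA + srcB − exitB ≤ sF · PAY + Erow`, `PAY ≥ 0`, with **`sF · d ≤ 4`**.
**`oneFcc_ledger`** — then `2Q ≤ PAY + EQ + (d/4)(Erow + Eex + 9 #K + 6 Φ M (Q_ψ + 2)) + 42 d M / S`
(the shifts `ψ` — height of the counts vs the charge — and `ψ' − ψ` — phase of the second plane system — cost `O(ΦM) = O(R)` by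
`unimodal_ap_shift_le`; the cell suprema cost `21 M` by `unimodal_cell_sup_sum_le`).  At `sF = 9/2`: `sF d = 3.674 ≤ 4`.
WHAT THIS IS NOT: no geometry, no cell; F-C1 not moved.
-/

namespace Summit.Ventures.Crystal3D.Theorems

open Finset

/-- `G(x) = √((K − x²)₊)` is antitone in `|x|`, nonnegative and bounded by `√K`. -/
theorem disc_profile_props (K : ℝ) (hK : 0 ≤ K) :
    (∀ x y : ℝ, |x| ≤ |y| → Real.sqrt (max 0 (K - y ^ 2)) ≤ Real.sqrt (max 0 (K - x ^ 2))) ∧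
    (∀ x : ℝ, 0 ≤ Real.sqrt (max 0 (K - x ^ 2))) ∧ (∀ x : ℝ, Real.sqrt (max 0 (K - x ^ 2)) ≤ Real.sqrt K) := by
  refine ⟨fun x y hxy => Real.sqrt_le_sqrt (max_le_max le_rfl ?_), fun x => Real.sqrt_nonneg _,
    fun x => Real.sqrt_le_sqrt (max_le hK (by nlinarith [sq_nonneg x]))⟩
  have := sq_le_sq.2 hxy
  linarith

/-- **THE TWO-FAMILY LEDGER.**  See the module docstring. -/
theorem oneFcc_ledger {d S R x₀ Φ ψ ψ' sF PAY srcA srcB exitB twoQ Erow Eex EQ : ℝ} {A B : ℤ} {Qψ : ℕ}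
    (hd : 0 < d) (hd2 : 1 ≤ 2 * d) (hS : 0 < S) (hR : 0 ≤ R) (hΦ : 4 / S ≤ Φ)
    (hψ : |ψ| ≤ Qψ * d) (hψ' : |ψ' - ψ| ≤ d) (hsFd : sF * d ≤ 4) (hPAY : 0 ≤ PAY)
    {ch wA wN : ℤ → ℝ} (hch : ∀ i, 0 ≤ ch i ∧ ch i ≤ 1) (hwA : ∀ k, 0 ≤ wA k ∧ wA k ≤ 1) (hwN : ∀ k, 0 ≤ wN k ∧ wN k ≤ 1)
    (hw : ∀ k, wA k + wN k = ch (k - 1) + ch k)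
    (hsrcA : ∑ k ∈ Finset.Icc A B, wA k * (Φ * Real.sqrt (max 0 (R ^ 2 * S ^ 2 - (x₀ + k * d + ψ) ^ 2)) - 3) ≤ srcA)
    (hsrcB : ∑ k ∈ Finset.Icc A B, (Φ * Real.sqrt (max 0 (R ^ 2 * S ^ 2 - (x₀ + k * d + ψ') ^ 2)) - 3) ≤ srcB)
    (hexitB : exitB ≤ ∑ k ∈ Finset.Icc A B, (1 - wN k) * (Φ * Real.sqrt (max 0 (R ^ 2 * S ^ 2 - (x₀ + k * d + ψ) ^ 2)) + 3) + Eex)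
    (hQ : twoQ ≤ 2 * d / S * ∑ i ∈ Finset.Icc A (B - 1), ch i *
      Real.sqrt (max 0 (R ^ 2 * S ^ 2 - (max (x₀ + i * d - 1) (min 0 (x₀ + (i + 1) * d + 1))) ^ 2)) + EQ)
    (hrow : srcA + srcB - exitB ≤ sF * PAY + Erow) :
    twoQ ≤ PAY + EQ + d / 4 * (Erow + Eex + 9 * ((Finset.Icc A B).card : ℝ) + 6 * (Φ * (R * S)) * (Qψ + 2)) +
      42 * d * R := by
  -- the profile `G` (kept opaque) and its three properties
  obtain ⟨G, hG⟩ : ∃ G : ℝ → ℝ, ∀ x, G x = Real.sqrt (max 0 (R ^ 2 * S ^ 2 - x ^ 2)) := ⟨_, fun _ => rfl⟩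
  set M : ℝ := R * S with hM
  have hM0 : 0 ≤ M := by positivity
  have hMK : Real.sqrt (R ^ 2 * S ^ 2) = M := by
    rw [show R ^ 2 * S ^ 2 = M ^ 2 by rw [hM]; ring, Real.sqrt_sq hM0]
  obtain ⟨hanti₀, hG0₀, hGM₀⟩ := disc_profile_props (R ^ 2 * S ^ 2) (by positivity)
  have hanti : ∀ x y : ℝ, |x| ≤ |y| → G y ≤ G x := fun x y h => by rw [hG, hG]; exact hanti₀ x y h
  have hG0 : ∀ x, 0 ≤ G x := fun x => by rw [hG]; exact hG0₀ x
  have hGM' : ∀ x, G x ≤ M := fun x => by rw [hG, ← hMK]; exact hGM₀ x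
  have hΦ0 : 0 ≤ Φ := le_trans (by positivity) hΦ
  simp only [← hG] at hsrcA hsrcB hexitB hQ
  set Kw := Finset.Icc A B with hKw
  have hKw_range : ∀ f : ℤ → ℝ, ∑ k ∈ Kw, f k = ∑ n ∈ Finset.range (B + 1 - A).toNat, f (A + n) := by
    intro f
    rw [hKw, Int.Icc_eq_finset_map, Finset.sum_map]
    exact Finset.sum_congr rfl fun n _ => by simp
  -- (1) the phase shift `ψ → ψ'` of the second plane system costs `6M`
  have hphase : ∑ k ∈ Kw, |G (x₀ + k * d + ψ') - G (x₀ + k * d + ψ)| ≤ 6 * M := by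
    rw [hKw_range (fun k => |G (x₀ + k * d + ψ') - G (x₀ + k * d + ψ)|)]
    have h := unimodal_ap_shift_le hanti hG0 hGM' hd (x₀ + A * d + ψ) (ψ' - ψ) 1 (by simpa using hψ')
      (B + 1 - A).toNat
    refine le_trans (le_of_eq (Finset.sum_congr rfl fun n _ => ?_)) (le_trans h (le_of_eq (by push_cast; ring)))
    push_cast
    ring_nf
  -- (2) the net count
  have hnet : Φ * ∑ k ∈ Kw, wA k * G (x₀ + k * d + ψ) + Φ * ∑ k ∈ Kw, wN k * G (x₀ + k * d + ψ)
      - 9 * (Kw.card : ℝ) - Φ * (6 * M) - Eex ≤ srcA + srcB - exitB := by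
    have e1 : ∑ k ∈ Kw, wA k * (Φ * G (x₀ + k * d + ψ) - 3) =
        Φ * ∑ k ∈ Kw, wA k * G (x₀ + k * d + ψ) - 3 * ∑ k ∈ Kw, wA k := by
      rw [Finset.mul_sum, Finset.mul_sum, ← Finset.sum_sub_distrib]
      exact Finset.sum_congr rfl fun k _ => by ring
    have e2 : ∑ k ∈ Kw, (Φ * G (x₀ + k * d + ψ') - 3) = Φ * ∑ k ∈ Kw, G (x₀ + k * d + ψ') - 3 * (Kw.card : ℝ) := by
      rw [Finset.sum_sub_distrib, Finset.mul_sum, Finset.sum_const, nsmul_eq_mul]; ring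
    have e3 : ∑ k ∈ Kw, (1 - wN k) * (Φ * G (x₀ + k * d + ψ) + 3) =
        Φ * ∑ k ∈ Kw, G (x₀ + k * d + ψ) - Φ * ∑ k ∈ Kw, wN k * G (x₀ + k * d + ψ) + 3 * ∑ k ∈ Kw, (1 - wN k) := by
      rw [Finset.mul_sum, Finset.mul_sum, Finset.mul_sum, ← Finset.sum_sub_distrib, ← Finset.sum_add_distrib]
      exact Finset.sum_congr rfl fun k _ => by ring
    have hwA1 : ∑ k ∈ Kw, wA k ≤ (Kw.card : ℝ) := by
      rw [Finset.card_eq_sum_ones, Nat.cast_sum]; push_cast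
      exact Finset.sum_le_sum fun k _ => (hwA k).2
    have hwN1 : ∑ k ∈ Kw, (1 - wN k) ≤ (Kw.card : ℝ) := by
      rw [Finset.card_eq_sum_ones, Nat.cast_sum]; push_cast
      exact Finset.sum_le_sum fun k _ => by linarith [(hwN k).1]
    have hph : Φ * ∑ k ∈ Kw, G (x₀ + k * d + ψ) - Φ * (6 * M) ≤ Φ * ∑ k ∈ Kw, G (x₀ + k * d + ψ') := by
      have h1 : ∑ k ∈ Kw, G (x₀ + k * d + ψ) - ∑ k ∈ Kw, G (x₀ + k * d + ψ') ≤ 6 * M := by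
        rw [← Finset.sum_sub_distrib]
        refine le_trans (Finset.sum_le_sum fun k _ => ?_) hphase
        rw [abs_sub_comm]; exact le_abs_self _
      have h2 := mul_le_mul_of_nonneg_left h1 hΦ0
      rw [mul_sub] at h2
      linarith
    rw [e1] at hsrcA
    rw [e2] at hsrcB
    rw [e3] at hexitB
    linarith
  -- (3) the height shift `ψ → 0`, with the weights `wA + wN ∈ [0, 2]`
  have hshift : ∑ k ∈ Kw, |G (x₀ + k * d + ψ) - G (x₀ + k * d)| ≤ 3 * (Qψ + 1) * M := by
    rw [hKw_range (fun k => |G (x₀ + k * d + ψ) - G (x₀ + k * d)|)]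
    have h := unimodal_ap_shift_le hanti hG0 hGM' hd (x₀ + A * d) ψ Qψ hψ (B + 1 - A).toNat
    refine le_trans (le_of_eq (Finset.sum_congr rfl fun n _ => ?_)) h
    push_cast
    ring_nf
  have hshift' : ∑ k ∈ Kw, (wA k + wN k) * G (x₀ + k * d) - 2 * (3 * (Qψ + 1) * M) ≤
      ∑ k ∈ Kw, wA k * G (x₀ + k * d + ψ) + ∑ k ∈ Kw, wN k * G (x₀ + k * d + ψ) := by
    have h1 : ∑ k ∈ Kw, (wA k + wN k) * G (x₀ + k * d) -
        (∑ k ∈ Kw, wA k * G (x₀ + k * d + ψ) + ∑ k ∈ Kw, wN k * G (x₀ + k * d + ψ)) ≤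
        2 * ∑ k ∈ Kw, |G (x₀ + k * d + ψ) - G (x₀ + k * d)| := by
      rw [← Finset.sum_add_distrib, ← Finset.sum_sub_distrib, Finset.mul_sum]
      refine Finset.sum_le_sum fun k _ => ?_
      have hw2 : 0 ≤ wA k + wN k ∧ wA k + wN k ≤ 2 :=
        ⟨by linarith [(hwA k).1, (hwN k).1], by linarith [(hwA k).2, (hwN k).2]⟩
      have h2 : (wA k + wN k) * G (x₀ + k * d) - (wA k * G (x₀ + k * d + ψ) + wN k * G (x₀ + k * d + ψ)) =
          (wA k + wN k) * (G (x₀ + k * d) - G (x₀ + k * d + ψ)) := by ring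
      rw [h2]
      calc (wA k + wN k) * (G (x₀ + k * d) - G (x₀ + k * d + ψ))
          ≤ (wA k + wN k) * |G (x₀ + k * d + ψ) - G (x₀ + k * d)| := by
            refine mul_le_mul_of_nonneg_left ?_ hw2.1
            rw [abs_sub_comm]; exact le_abs_self _
        _ ≤ 2 * |G (x₀ + k * d + ψ) - G (x₀ + k * d)| := mul_le_mul_of_nonneg_right hw2.2 (abs_nonneg _)
    linarith
  -- (4) re-index: `Σ_k (ch (k−1) + ch k) G(x_k) ≥ Σ_{i=A}^{B−1} ch i (G(x_i) + G(x_{i+1}))`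
  have hreindex : ∑ i ∈ Finset.Icc A (B - 1), ch i * (G (x₀ + i * d) + G (x₀ + (i + 1) * d)) ≤
      ∑ k ∈ Kw, (wA k + wN k) * G (x₀ + k * d) := by
    have hsplit : ∑ i ∈ Finset.Icc A (B - 1), ch i * (G (x₀ + i * d) + G (x₀ + (i + 1) * d)) =
        ∑ i ∈ Finset.Icc A (B - 1), ch i * G (x₀ + i * d) + ∑ i ∈ Finset.Icc A (B - 1), ch i * G (x₀ + (i + 1) * d) := by
      rw [← Finset.sum_add_distrib]; exact Finset.sum_congr rfl fun i _ => by ring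
    have hw' : ∑ k ∈ Kw, (wA k + wN k) * G (x₀ + k * d) =
        ∑ k ∈ Kw, ch (k - 1) * G (x₀ + k * d) + ∑ k ∈ Kw, ch k * G (x₀ + k * d) := by
      rw [← Finset.sum_add_distrib]; exact Finset.sum_congr rfl fun k _ => by rw [hw k]; ring
    rw [hsplit, hw']
    have hnn : ∀ i : ℤ, 0 ≤ ch i * G (x₀ + i * d) := fun i => mul_nonneg (hch i).1 (hG0 _)
    have hnn' : ∀ i : ℤ, 0 ≤ ch (i - 1) * G (x₀ + i * d) := fun i => mul_nonneg (hch (i - 1)).1 (hG0 _)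
    have h1 : ∑ i ∈ Finset.Icc A (B - 1), ch i * G (x₀ + i * d) ≤ ∑ k ∈ Kw, ch k * G (x₀ + k * d) := by
      refine Finset.sum_le_sum_of_subset_of_nonneg (fun i hi => ?_) fun i _ _ => hnn i
      rw [Finset.mem_Icc] at hi ⊢; omega
    have h2 : ∑ i ∈ Finset.Icc A (B - 1), ch i * G (x₀ + (i + 1) * d) ≤ ∑ k ∈ Kw, ch (k - 1) * G (x₀ + k * d) := by
      have himg : ∑ i ∈ Finset.Icc A (B - 1), ch i * G (x₀ + (i + 1) * d) =
          ∑ k ∈ (Finset.Icc A (B - 1)).image (fun i => i + 1), ch (k - 1) * G (x₀ + k * d) := by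
        rw [Finset.sum_image (fun a _ b _ h => by simpa using h)]
        exact Finset.sum_congr rfl fun i _ => by push_cast; simp only [add_sub_cancel_right]
      rw [himg]
      refine Finset.sum_le_sum_of_subset_of_nonneg (fun k hk => ?_) fun k _ _ => hnn' k
      obtain ⟨i, hi, rfl⟩ := Finset.mem_image.1 hk
      rw [Finset.mem_Icc] at hi ⊢; omega
    linarith
  -- (5) the charge side: cell suprema against the two bounding planes
  obtain ⟨e, he0, hecell, hesum⟩ := unimodal_cell_sup_sum_le hanti hG0 hGM' hd hd2 x₀
  set Sc := ∑ i ∈ Finset.Icc A (B - 1), ch i * (G (x₀ + i * d) + G (x₀ + (i + 1) * d)) with hSc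
  have hSc0 : 0 ≤ Sc := Finset.sum_nonneg fun i _ => mul_nonneg (hch i).1 (add_nonneg (hG0 _) (hG0 _))
  have hcharge : ∑ i ∈ Finset.Icc A (B - 1), ch i * G (max (x₀ + i * d - 1) (min 0 (x₀ + (i + 1) * d + 1))) ≤
      Sc / 2 + 21 * M := by
    have hes : ∑ i ∈ Finset.Icc A (B - 1), e i ≤ 21 * M := by
      rw [Int.Icc_eq_finset_map, Finset.sum_map]
      refine le_trans (le_of_eq (Finset.sum_congr rfl fun n _ => ?_)) (hesum A (B - 1 + 1 - A).toNat)
      simp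
    calc ∑ i ∈ Finset.Icc A (B - 1), ch i * G (max (x₀ + i * d - 1) (min 0 (x₀ + (i + 1) * d + 1)))
        ≤ ∑ i ∈ Finset.Icc A (B - 1), (ch i * ((G (x₀ + i * d) + G (x₀ + (i + 1) * d)) / 2) + e i) := by
          refine Finset.sum_le_sum fun i _ => ?_
          have hci := hch i
          calc ch i * G (max (x₀ + ↑i * d - 1) (min 0 (x₀ + (↑i + 1) * d + 1)))
              ≤ ch i * ((G (x₀ + ↑i * d) + G (x₀ + (↑i + 1) * d)) / 2 + e i) :=
                mul_le_mul_of_nonneg_left (hecell i) hci.1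
            _ ≤ ch i * ((G (x₀ + ↑i * d) + G (x₀ + (↑i + 1) * d)) / 2) + e i := by
                nlinarith [he0 i, hci.2, hG0 (x₀ + ↑i * d), hG0 (x₀ + (↑i + 1) * d)]
      _ = Sc / 2 + ∑ i ∈ Finset.Icc A (B - 1), e i := by
          rw [Finset.sum_add_distrib, hSc, Finset.sum_div]
          congr 1; exact Finset.sum_congr rfl fun i _ => by ring
      _ ≤ _ := by linarith
  -- (6) assemble
  have hQ' : twoQ ≤ 2 * d / S * (Sc / 2 + 21 * M) + EQ := by
    have h0 : 0 ≤ 2 * d / S := by positivity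
    have := mul_le_mul_of_nonneg_left hcharge h0
    linarith [hQ]
  have hchain : Φ * Sc ≤ sF * PAY + Erow + Eex + 9 * (Kw.card : ℝ) + Φ * (6 * M) + Φ * (2 * (3 * (Qψ + 1) * M)) := by
    have h1 : Φ * Sc ≤ Φ * ∑ k ∈ Kw, (wA k + wN k) * G (x₀ + k * d) := mul_le_mul_of_nonneg_left hreindex hΦ0
    have h2 := mul_le_mul_of_nonneg_left hshift' hΦ0
    rw [mul_sub, mul_add] at h2
    linarith [hnet, hrow]
  have hkey : 2 * d / S * (Sc / 2) ≤ d / 4 * (Φ * Sc) := by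
    have : 2 * d / S * (Sc / 2) = d / 4 * (4 / S * Sc) := by field_simp
    rw [this]
    exact mul_le_mul_of_nonneg_left (mul_le_mul_of_nonneg_right hΦ hSc0) (by positivity)
  have hPAYterm : d / 4 * (sF * PAY) ≤ PAY := by
    rw [show d / 4 * (sF * PAY) = (sF * d / 4) * PAY by ring]
    exact mul_le_of_le_one_left hPAY (by linarith)
  have hMS : 2 * d / S * (21 * M) = 42 * d * R := by rw [hM]; field_simp; ring
  have hdist : 2 * d / S * (Sc / 2 + 21 * M) = 2 * d / S * (Sc / 2) + 2 * d / S * (21 * M) := by ring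
  rw [hdist, hMS] at hQ'
  have hfin := mul_le_mul_of_nonneg_left hchain (show (0:ℝ) ≤ d / 4 by positivity)
  have e : d / 4 * (sF * PAY + Erow + Eex + 9 * (Kw.card : ℝ) + Φ * (6 * M) + Φ * (2 * (3 * (Qψ + 1) * M))) =
      d / 4 * (sF * PAY) + d / 4 * (Erow + Eex + 9 * (Kw.card : ℝ) + 6 * (Φ * M) * (Qψ + 2)) := by ring
  rw [e] at hfin
  linarith [hQ', hkey, hfin, hPAYterm]

end Summit.Ventures.Crystal3D.Theorems
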